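import Mathlib
import HarnessLib

/-!
# The exact non-radiative chain `e_j = c_j ι^{ℓ−j}` of `−∂² + ℓ(ℓ+1)ι²`

Analysis/ODE support file (everything proved, no definitions). For a coefficient function `ι` with
`ι = 1/x` on `[½, ∞)` (so that `ι' = −ι²` there) the functions `e_j(x) = c_j ι(x)^{ℓ−j}`
(`0 ≤ j ≤ ℓ`) satisfy on `x > ½`

  `e_j'' = ℓ(ℓ+1) ι² e_j + j(j−1) e_{j−2}`

as soon as the coefficients obey `(j−1) c_{j−2} = (j−2ℓ−1) c_j` (`j ≥ 2`) and `c₁ = 0` when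
`ℓ ≥ 1` (`exact_chain_deriv_deriv`); these are the `x`-profiles of the solutions of
`ψ_tt − ψ_xx + ℓ(ℓ+1)x⁻²ψ = 0` that are POLYNOMIAL in `t` (the non-radiative kernel of the exterior
channel estimate in odd space dimension `2ℓ+3`, Kenig–Lawrie–Liu–Schlag, Adv. Math. 285 (2015)):
`P_m(t,x) = Σ_i binom(m,i) e_{m−i}(x) tⁱ`. The explicit choice
`c_j = ∏_{k<ℓ} (j − 2k − 1)` — the image `ladder ι ℓ (y ↦ y^j) = c_j ι^{ℓ−j}` of the monomials
under the Darboux ladder — satisfies both relations (`towerCoeff_rec`, `towerCoeff_one`). Also: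
smoothness and the power bounds `|e_j| = |c_j| x^{j−ℓ}`, `|e_j'| ≤ |c_j| ℓ x^{j−ℓ−1}` on `[1,∞)`.
Use: the true t-polynomial kernel on the null-infinity side of the Regge–Wheeler channel estimate
`FixedModeChannels` (route PhotonSphereChannels, stmt-FinalStateConjecture-10048).
-/

noncomputable section

namespace Literature.Analysis.ODE

open Set Filter Topology Finset

/-! ### The explicit coefficients -/

/-- The recursion `(j−1)c_{j−2} = (j−2ℓ−1)c_j` for `c_j = ∏_{k<ℓ}(j−2k−1)`, `j ≥ 2`. [folklore] -/
theorem towerCoeff_rec (ℓ : ℕ) {j : ℕ} (hj : 2 ≤ j) :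
    ((j : ℝ) - 1) * ∏ k ∈ range ℓ, (((j - 2 : ℕ) : ℝ) - 2 * k - 1)
      = ((j : ℝ) - 2 * ℓ - 1) * ∏ k ∈ range ℓ, ((j : ℝ) - 2 * k - 1) := by
  have hcast : ((j - 2 : ℕ) : ℝ) = (j : ℝ) - 2 := by
    rw [Nat.cast_sub hj]; norm_num
  simp_rw [hcast]
  have h1 : ∏ k ∈ range (ℓ + 1), ((j : ℝ) - 2 * k - 1)
      = (∏ k ∈ range ℓ, ((j : ℝ) - 2 * ((k + 1 : ℕ) : ℝ) - 1)) * ((j : ℝ) - 2 * ((0 : ℕ) : ℝ) - 1) :=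
    prod_range_succ' _ _
  have h2 : ∏ k ∈ range (ℓ + 1), ((j : ℝ) - 2 * k - 1)
      = (∏ k ∈ range ℓ, ((j : ℝ) - 2 * k - 1)) * ((j : ℝ) - 2 * ℓ - 1) := prod_range_succ _ _
  have h3 : ∏ k ∈ range ℓ, ((j : ℝ) - 2 - 2 * k - 1)
      = ∏ k ∈ range ℓ, ((j : ℝ) - 2 * ((k + 1 : ℕ) : ℝ) - 1) :=
    prod_congr rfl fun k _ => by push_cast; ring
  rw [h3]
  have e : (∏ k ∈ range ℓ, ((j : ℝ) - 2 * ((k + 1 : ℕ) : ℝ) - 1)) * ((j : ℝ) - 1)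
      = (∏ k ∈ range ℓ, ((j : ℝ) - 2 * k - 1)) * ((j : ℝ) - 2 * ℓ - 1) := by
    rw [← h2, h1]; push_cast; ring
  linear_combination e

/-- `c₁ = 0` when `ℓ ≥ 1` (the factor `k = 0` vanishes). [folklore] -/
theorem towerCoeff_one {ℓ : ℕ} (hℓ : 1 ≤ ℓ) :
    ∏ k ∈ range ℓ, (((1 : ℕ) : ℝ) - 2 * k - 1) = 0 := by
  obtain ⟨n, rfl⟩ := Nat.exists_eq_add_of_le hℓ
  rw [show 1 + n = n + 1 by ring, prod_range_succ']
  simp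

/-! ### The exact chain -/

section ExactChain

variable {ι : ℝ → ℝ}

/-- Powers of `ι` agree with integer powers of `x` on `x > ½`. [folklore] -/
theorem iota_pow_eventuallyEq (hιeq : ∀ x : ℝ, 1 / 2 ≤ x → ι x = x⁻¹) (n : ℕ) (a : ℝ) {x : ℝ}
    (hx : 1 / 2 < x) : (fun y => a * ι y ^ n) =ᶠ[𝓝 x] fun y => a * y ^ (-(n : ℤ)) :=
  Filter.mem_of_superset (Ioi_mem_nhds hx) fun y hy => by
    have hy' : 1 / 2 ≤ y := le_of_lt hy
    show a * ι y ^ n = a * y ^ (-(n : ℤ))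
    rw [hιeq y hy', zpow_neg, zpow_natCast, inv_pow]

/-- First derivative of `a ι^n` on `x > ½`: `−n a x^{−n−1}`. [folklore] -/
theorem deriv_const_mul_iota_pow (hιeq : ∀ x : ℝ, 1 / 2 ≤ x → ι x = x⁻¹) (n : ℕ) (a : ℝ) {x : ℝ}
    (hx : 1 / 2 < x) :
    deriv (fun y => a * ι y ^ n) x = a * (-(n : ℝ)) * x ^ (-(n : ℤ) - 1) := by
  rw [(iota_pow_eventuallyEq hιeq n a hx).deriv_eq, deriv_const_mul_field, deriv_zpow]
  push_cast; ring

/-- Second derivative of `a ι^n` on `x > ½`: `n(n+1) a x^{−n−2}`. [folklore] -/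
theorem deriv_deriv_const_mul_iota_pow (hιeq : ∀ x : ℝ, 1 / 2 ≤ x → ι x = x⁻¹) (n : ℕ) (a : ℝ)
    {x : ℝ} (hx : 1 / 2 < x) :
    deriv (deriv fun y => a * ι y ^ n) x = a * ((n : ℝ) * (n + 1)) * x ^ (-(n : ℤ) - 2) := by
  have hev : deriv (fun y => a * ι y ^ n) =ᶠ[𝓝 x] fun y => a * (-(n : ℝ)) * y ^ (-(n : ℤ) - 1) :=
    Filter.mem_of_superset (Ioi_mem_nhds hx) fun y hy => deriv_const_mul_iota_pow hιeq n a hy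
  rw [hev.deriv_eq, deriv_const_mul_field, deriv_zpow, show -(n : ℤ) - 1 - 1 = -(n : ℤ) - 2 by ring]
  push_cast; ring

/-- `a ι^n` is smooth if `ι` is. [folklore] -/
theorem contDiff_const_mul_iota_pow (hι : ContDiff ℝ (⊤ : ℕ∞) ι) (n : ℕ) (a : ℝ) {m : ℕ∞} :
    ContDiff ℝ m fun y => a * ι y ^ n :=
  (contDiff_const.mul (hι.pow n)).of_le (by exact_mod_cast le_top)

/-- **The exact chain identity** `e_j'' = ℓ(ℓ+1)ι²e_j + j(j−1)e_{j−2}` on `x > ½`, for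
`e_j = c_j ι^{ℓ−j}` with `(j−1)c_{j−2} = (j−2ℓ−1)c_j` (`j ≥ 2`) and `c₁ = 0` if `ℓ ≥ 1`; `j ≤ ℓ`.
(The `x`-profiles of the t-polynomial solutions of `ψ_tt − ψ_xx + ℓ(ℓ+1)x⁻²ψ = 0`.) [folklore] -/
theorem exact_chain_deriv_deriv (hιeq : ∀ x : ℝ, 1 / 2 ≤ x → ι x = x⁻¹) (ℓ : ℕ) {c : ℕ → ℝ}
    (hc : ∀ j : ℕ, 2 ≤ j → ((j : ℝ) - 1) * c (j - 2) = ((j : ℝ) - 2 * ℓ - 1) * c j)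
    (hc1 : 1 ≤ ℓ → c 1 = 0) {j : ℕ} (hj : j ≤ ℓ) {x : ℝ} (hx : 1 / 2 < x) :
    deriv (deriv fun y => c j * ι y ^ (ℓ - j)) x
      = (ℓ : ℝ) * (ℓ + 1) * ι x ^ 2 * (c j * ι x ^ (ℓ - j))
        + (j : ℝ) * (j - 1) * (c (j - 2) * ι x ^ (ℓ - (j - 2))) := by
  have hx0 : x ≠ 0 := by intro h; rw [h] at hx; norm_num at hx
  have hιx : ι x = x⁻¹ := hιeq x hx.le
  rw [deriv_deriv_const_mul_iota_pow hιeq (ℓ - j) (c j) hx, hιx, inv_pow, inv_pow, inv_pow]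
  have hn : ((ℓ - j : ℕ) : ℝ) = ℓ - j := by rw [Nat.cast_sub hj]
  have e1 : x ^ (-((ℓ - j : ℕ) : ℤ) - 2) = (x ^ 2)⁻¹ * (x ^ (ℓ - j))⁻¹ := by
    rw [← zpow_natCast x 2, ← zpow_natCast x (ℓ - j), ← zpow_neg, ← zpow_neg, ← zpow_add₀ hx0]
    congr 1; ring
  rcases Nat.lt_or_ge j 2 with hj2 | hj2
  · -- `j = 0, 1`: the lower term vanishes
    have hz : (j : ℝ) * (j - 1) = 0 := by interval_cases j <;> norm_num
    have coef : c j * (((ℓ - j : ℕ) : ℝ) * ((ℓ - j : ℕ) + 1)) = (ℓ : ℝ) * (ℓ + 1) * c j := by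
      interval_cases j
      · simp only [Nat.sub_zero]; ring
      · rw [hc1 (by omega)]; ring
    rw [hz, zero_mul, add_zero, e1, ← mul_assoc, coef]
    ring
  · -- `j ≥ 2`
    have hn2 : ℓ - (j - 2) = (ℓ - j) + 2 := by omega
    have coef : c j * (((ℓ - j : ℕ) : ℝ) * ((ℓ - j : ℕ) + 1))
        = (ℓ : ℝ) * (ℓ + 1) * c j + (j : ℝ) * (j - 1) * c (j - 2) := by
      rw [hn]
      have := hc j hj2
      linear_combination (-(j : ℝ)) * this
    rw [hn2, pow_add, mul_inv, e1, ← mul_assoc, coef]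
    ring

/-- Power bounds of the exact chain on `[1, ∞)`: `|e_j| = |c_j| x^{j−ℓ}` and
`|e_j'| ≤ |c_j| ℓ x^{j−ℓ−1}` (real powers, `j ≤ ℓ`). [folklore] -/
theorem exact_chain_bounds (hιeq : ∀ x : ℝ, 1 / 2 ≤ x → ι x = x⁻¹) (ℓ : ℕ) (c : ℕ → ℝ) {j : ℕ}
    (hj : j ≤ ℓ) {x : ℝ} (hx : 1 ≤ x) :
    |c j * ι x ^ (ℓ - j)| = |c j| * x ^ ((j : ℝ) - ℓ) ∧
      |deriv (fun y => c j * ι y ^ (ℓ - j)) x| ≤ |c j| * ℓ * x ^ ((j : ℝ) - ℓ - 1) := by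
  have hx0 : 0 < x := by linarith
  have hx2 : 1 / 2 < x := by linarith
  have hιx : ι x = x⁻¹ := hιeq x hx2.le
  have hn : ((ℓ - j : ℕ) : ℝ) = ℓ - j := by rw [Nat.cast_sub hj]
  have r1 : x ^ ((j : ℝ) - ℓ) = (x ^ (ℓ - j))⁻¹ := by
    rw [show (j : ℝ) - ℓ = -((ℓ - j : ℕ) : ℝ) by rw [hn]; ring, Real.rpow_neg hx0.le,
      Real.rpow_natCast]
  have r2 : x ^ ((j : ℝ) - ℓ - 1) = x ^ (-((ℓ - j : ℕ) : ℤ) - 1) := by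
    rw [← Real.rpow_intCast]; congr 1; push_cast; rw [hn]; ring
  constructor
  · rw [abs_mul, hιx, inv_pow, abs_inv, abs_of_pos (pow_pos hx0 _), r1]
  · rw [deriv_const_mul_iota_pow hιeq (ℓ - j) (c j) hx2, hn, r2]
    have hz : 0 ≤ x ^ (-((ℓ - j : ℕ) : ℤ) - 1) := (zpow_pos hx0 _).le
    have hℓj0 : (0 : ℝ) ≤ ℓ - j := sub_nonneg.2 (by exact_mod_cast hj)
    have hℓj : (ℓ : ℝ) - j ≤ ℓ := by linarith [(Nat.cast_nonneg j : (0 : ℝ) ≤ j)]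
    rw [show c j * -((ℓ : ℝ) - j) * x ^ (-((ℓ - j : ℕ) : ℤ) - 1)
        = -(c j * (((ℓ : ℝ) - j) * x ^ (-((ℓ - j : ℕ) : ℤ) - 1))) by ring, abs_neg, abs_mul,
      abs_of_nonneg (mul_nonneg hℓj0 hz)]
    calc |c j| * (((ℓ : ℝ) - j) * x ^ (-((ℓ - j : ℕ) : ℤ) - 1))
        ≤ |c j| * ((ℓ : ℝ) * x ^ (-((ℓ - j : ℕ) : ℤ) - 1)) := by gcongr
      _ = |c j| * ℓ * x ^ (-((ℓ - j : ℕ) : ℤ) - 1) := by ring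

end ExactChain

end Literature.Analysis.ODE
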